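import Mathlib
import Summits.ValiantsHypothesis.ValiantsHypothesis.Theses.LiouvilleSarnak
import Summits.ValiantsHypothesis.ValiantsHypothesis.Theorems.LiouvilleSarnakLiouvilleCutRankBoundedChanges
import Summits.ValiantsHypothesis.ValiantsHypothesis.Theorems.LiouvilleSarnakLiouvilleCutRankTwoAdicTwinRuns
import Literature.LinearAlgebra.Matrix.HadamardProductRank

/-!
# Route LiouvilleSarnak — crux `LiouvilleCutRank` (stmt-ValiantsHypothesis-14775): the crux IS the many-changes
# regime, and it holds unconditionally for the PAIR `{λ, λ_odd}`

Two structural facts about the OPEN crux (`∀ W`, eventually every balanced cut matrix `M_π(λ) = (λ(N_π(r,c)+1))`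
has rank `≥ W`), assembled from landed pieces:

* ★ `liouvilleCutRank_iff_manyChanges` — BY NAME: `LiouvilleCutRank` is EQUIVALENT to its restriction to cut words
  with MANY letter changes: `∀ W ∃ K n₁ ∀ n ≥ n₁ ∀ π`, if the row/column word of `π` has `≥ K` letter changes then
  `rank M_π(λ) ≥ W`.  (`⇐`: words with `≤ K` changes are the landed class `…BoundedChanges.le_rank_of_changes_le`
  (p830257); `⇒`: `K = 0`.)  So the residual class of the census ("bounded-run / many-runs words") is not a
  description but the crux itself, complementary to the non-automaticity classes.
* `liouville_mul_twoAdicSign` — the ODD-PART twin `λ_odd(m) := λ(m) (-1)^{v₂(m)} = λ(m / 2^{v₂(m)})` (completely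
  multiplicative, `λ_odd(2) = +1`, `λ_odd(p) = -1` at odd primes); `hadamard_liouville_oddTwin` — entrywise
  `M_π(λ) ⊙ M_π(λ_odd) = M_π(f₀)`, `f₀ = (-1)^{v₂}` the two-adic twin.
* ★ `card_rowRunTops_le_rank_mul_rank` — on EVERY cut, `#(tops of row runs) ≤ rank M_π(λ) · rank M_π(λ_odd)`
  (`…TwoAdicTwinRuns.card_rowRunTops_le_rank_twoAdicSign` (p831209) and `rk(A ⊙ B) ≤ rk A · rk B`,
  `Literature.LinearAlgebra.Matrix.HadamardProductRank.rank_hadamard_le`); `card_changes_le_card_tops_add` — the letter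
  changes inject into the run tops, so `#changes ≤ 2 · rank M_π(λ) · rank M_π(λ_odd)` (`changes_le_two_mul_rank_mul_rank`).
* ★★ `le_max_rank_liouville_oddTwin` — THE CRUX FOR THE PAIR, unconditionally: `∀ W ∃ n₀ ∀ n ≥ n₀ ∀ π` (every
  balanced cut), `W ≤ max (rank M_π(λ)) (rank M_π(λ_odd))`.  (Few changes: `λ` alone by p830257; `> 2W²` changes:
  `rank(λ) · rank(λ_odd) > W²`.)  Equivalently: on any hypothetical bad cut family for `λ` (rank `< W`), the
  odd-part twin carries rank `> #changes / (2W) → ∞` — the obstruction to the crux is `2`-adic twisting of the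
  digital structure, nothing else survives.

Honest framing: reformulation + an unconditional theorem about the pair `{λ, λ_odd}`; it does NOT prove
`LiouvilleCutRank` for `λ` (nor for `λ_odd`); `LiouvilleCutRank`, `DigitalBilinearLiouville`, `AlgebraicSarnak` stay
OPEN; nothing here bears on `VP ≠ VNP`.  No definitions (`λ_odd`, `f₀` are explicit terms).
-/

set_option linter.dupNamespace false

noncomputable section

namespace Summit.ValiantsHypothesis.ValiantsHypothesis.Theorems.LiouvilleSarnakLiouvilleCutRank.ManyChanges

open ArithmeticFunction Finset
open scoped Matrix

open Summit.ValiantsHypothesis.ValiantsHypothesis.Theses.LiouvilleSarnak (LiouvilleCutRank)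
open Summit.ValiantsHypothesis.ValiantsHypothesis.Theorems.LiouvilleSarnakLiouvilleCutRank.BoundedChanges
  (le_rank_of_changes_le)
open Summit.ValiantsHypothesis.ValiantsHypothesis.Theorems.LiouvilleSarnakLiouvilleCutRank.TwoAdicTwinRuns
  (card_rowRunTops_le_rank_twoAdicSign card_colRunTops_le_rank_twoAdicSign)
open Literature.LinearAlgebra.Matrix.HadamardProductRank (rank_hadamard_le)

/-! ### §1 The crux is the many-changes regime -/

/-- ★ **`LiouvilleCutRank` ⟺ its many-changes case.**  The crux holds iff for every `W` there are `K, n₁` such that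
at every level `n ≥ n₁`, every balanced cut whose row/column word `w` (`w j = (π.symm j).isLeft`) has AT LEAST `K`
letter changes (`K ≤ #{k < 2n-1 : w k ≠ w (k+1)}`) has cut-matrix rank `≥ W`.  The words with fewer changes are the
landed class `BoundedChanges.le_rank_of_changes_le`. [this file] -/
theorem liouvilleCutRank_iff_manyChanges :
    LiouvilleCutRank ↔
      ∀ W : ℕ, ∃ K n₁ : ℕ, ∀ n : ℕ, n₁ ≤ n →
        ∀ (π : Fin n ⊕ Fin n ≃ Fin (2 * n)) (w : ℕ → Bool),
          (∀ j : Fin (2 * n), w j = (π.symm j).isLeft) →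
          K ≤ ((range (2 * n - 1)).filter fun k => w k ≠ w (k + 1)).card →
          W ≤ (Matrix.of fun r c : Fin n → Bool =>
            (((liouville (Nat.ofBits (fun k : Fin (2 * n) => Sum.elim r c (π.symm k)) + 1) : ℤ) :
              ℂ))).rank := by
  constructor
  · intro h W
    obtain ⟨n₀, hn₀⟩ := h W
    exact ⟨0, n₀, fun n hn π w _ _ => hn₀ n hn π⟩
  · intro h W
    obtain ⟨K, n₁, hK⟩ := h W
    obtain ⟨n₀, hn₀⟩ := le_rank_of_changes_le K W
    refine ⟨max n₀ n₁, fun n hn π => ?_⟩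
    set w : ℕ → Bool := fun k => if hk : k < 2 * n then (π.symm ⟨k, hk⟩).isLeft else false with hw_def
    have hw : ∀ j : Fin (2 * n), w j = (π.symm j).isLeft := fun j => by simp [hw_def, j.isLt]
    by_cases hc : ((range (2 * n - 1)).filter fun k => w k ≠ w (k + 1)).card ≤ K
    · exact hn₀ n (le_of_max_le_left hn) π w hw hc
    · exact hK n (le_of_max_le_right hn) π w hw (by omega)

/-! ### §2 The odd-part twin and the Hadamard factorisation -/

/-- **The odd-part twin.**  `λ(m) · (-1)^{v₂(m)} = λ(m / 2^{v₂(m)})`: removing the prime `2` from `λ`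
(`λ(2^v M) = (-1)^v λ(M)`; at `m = 0` both sides vanish, Mathlib's `λ 0 = 0`). [folklore] -/
theorem liouville_mul_twoAdicSign (m : ℕ) :
    ((liouville m : ℤ) : ℂ) * (-1 : ℂ) ^ (m.factorization 2) =
      ((liouville (m / 2 ^ (m.factorization 2)) : ℤ) : ℂ) := by
  set v := m.factorization 2 with hv
  set M := m / 2 ^ v with hM
  have hsplit : m = 2 ^ v * M := (Nat.ordProj_mul_ordCompl_eq_self m 2).symm
  have h2v : liouville (2 ^ v) = (-1) ^ v := by
    rw [liouville_apply (pow_ne_zero _ two_ne_zero), cardFactors_apply_prime_pow Nat.prime_two]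
  have hl : liouville m = (-1) ^ v * liouville M := by
    conv_lhs => rw [hsplit]
    rw [liouville_apply_mul, h2v]
  rw [hl]
  push_cast
  rw [mul_comm ((-1 : ℂ) ^ v) _, mul_assoc, ← mul_pow]
  norm_num

/-- **Hadamard factorisation.**  Entrywise, `λ(N+1) · (λ(N+1) (-1)^{v₂(N+1)}) = (-1)^{v₂(N+1)}` (`λ² = 1` on positive
integers): the two-adic twin's cut matrix is the Hadamard product of the cut matrices of `λ` and of `λ_odd`, for every
cut. [this file] -/
theorem hadamard_liouville_oddTwin (n : ℕ) (π : Fin n ⊕ Fin n ≃ Fin (2 * n)) :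
    (Matrix.of fun r c : Fin n → Bool =>
        (((liouville (Nat.ofBits (fun k : Fin (2 * n) => Sum.elim r c (π.symm k)) + 1) : ℤ) : ℂ))) ⊙
      (Matrix.of fun r c : Fin n → Bool =>
        (((liouville (Nat.ofBits (fun k : Fin (2 * n) => Sum.elim r c (π.symm k)) + 1) : ℤ) : ℂ)) *
          (-1 : ℂ) ^ ((Nat.ofBits (fun k : Fin (2 * n) => Sum.elim r c (π.symm k)) + 1).factorization 2)) =
      (Matrix.of fun r c : Fin n → Bool =>
        (-1 : ℂ) ^ ((Nat.ofBits (fun k : Fin (2 * n) => Sum.elim r c (π.symm k)) + 1).factorization 2)) := by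
  ext r c
  simp only [Matrix.hadamard_apply, Matrix.of_apply]
  set N := Nat.ofBits (fun k : Fin (2 * n) => Sum.elim r c (π.symm k)) with hN
  have hsq : ((liouville (N + 1) : ℤ) : ℂ) * ((liouville (N + 1) : ℤ) : ℂ) = 1 := by
    rw [liouville_apply (Nat.succ_ne_zero N)]
    push_cast
    rw [← mul_pow]
    norm_num
  rw [← mul_assoc, hsq, one_mul]

/-- ★ **Row-run tops versus the pair.**  On EVERY cut `π`: `#(tops of row runs) ≤ rank M_π(λ) · rank M_π(λ_odd)`
(`…TwoAdicTwinRuns.card_rowRunTops_le_rank_twoAdicSign` for `f₀ = λ ⊙ λ_odd`, and `rk (A ⊙ B) ≤ rk A · rk B`).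
[this file] -/
theorem card_rowRunTops_le_rank_mul_rank (n : ℕ) (π : Fin n ⊕ Fin n ≃ Fin (2 * n)) :
    (Finset.univ.filter fun i : Fin n =>
        ∀ i' : Fin n, (π (Sum.inl i') : ℕ) ≠ (π (Sum.inl i) : ℕ) + 1).card ≤
      (Matrix.of fun r c : Fin n → Bool =>
          (((liouville (Nat.ofBits (fun k : Fin (2 * n) => Sum.elim r c (π.symm k)) + 1) : ℤ) : ℂ))).rank *
        (Matrix.of fun r c : Fin n → Bool =>
          (((liouville (Nat.ofBits (fun k : Fin (2 * n) => Sum.elim r c (π.symm k)) + 1) : ℤ) : ℂ)) *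
            (-1 : ℂ) ^ ((Nat.ofBits (fun k : Fin (2 * n) => Sum.elim r c (π.symm k)) + 1).factorization 2)).rank := by
  classical
  refine (card_rowRunTops_le_rank_twoAdicSign n π).trans ?_
  rw [← hadamard_liouville_oddTwin n π]
  exact rank_hadamard_le _ _

/-- The column version: `#(tops of column runs) ≤ rank M_π(λ) · rank M_π(λ_odd)`. [this file] -/
theorem card_colRunTops_le_rank_mul_rank (n : ℕ) (π : Fin n ⊕ Fin n ≃ Fin (2 * n)) :
    (Finset.univ.filter fun i : Fin n =>
        ∀ i' : Fin n, (π (Sum.inr i') : ℕ) ≠ (π (Sum.inr i) : ℕ) + 1).card ≤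
      (Matrix.of fun r c : Fin n → Bool =>
          (((liouville (Nat.ofBits (fun k : Fin (2 * n) => Sum.elim r c (π.symm k)) + 1) : ℤ) : ℂ))).rank *
        (Matrix.of fun r c : Fin n → Bool =>
          (((liouville (Nat.ofBits (fun k : Fin (2 * n) => Sum.elim r c (π.symm k)) + 1) : ℤ) : ℂ)) *
            (-1 : ℂ) ^ ((Nat.ofBits (fun k : Fin (2 * n) => Sum.elim r c (π.symm k)) + 1).factorization 2)).rank := by
  classical
  refine (card_colRunTops_le_rank_twoAdicSign n π).trans ?_
  rw [← hadamard_liouville_oddTwin n π]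
  exact rank_hadamard_le _ _

/-! ### §3 Letter changes inject into run tops -/

/-- **Changes versus tops.**  Every letter change `w k ≠ w (k+1)` (`k < 2n - 1`) of the row/column word sits at the top
`k` of a run of the letter `w k`; hence `#changes ≤ #(row-run tops) + #(column-run tops)`. [this file] -/
theorem card_changes_le_card_tops_add (n : ℕ) (π : Fin n ⊕ Fin n ≃ Fin (2 * n)) (w : ℕ → Bool)
    (hw : ∀ j : Fin (2 * n), w j = (π.symm j).isLeft) :
    ((range (2 * n - 1)).filter fun k => w k ≠ w (k + 1)).card ≤
      (Finset.univ.filter fun i : Fin n =>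
          ∀ i' : Fin n, (π (Sum.inl i') : ℕ) ≠ (π (Sum.inl i) : ℕ) + 1).card +
        (Finset.univ.filter fun i : Fin n =>
          ∀ i' : Fin n, (π (Sum.inr i') : ℕ) ≠ (π (Sum.inr i) : ℕ) + 1).card := by
  classical
  set TR := (Finset.univ.filter fun i : Fin n =>
      ∀ i' : Fin n, (π (Sum.inl i') : ℕ) ≠ (π (Sum.inl i) : ℕ) + 1) with hTR
  set TC := (Finset.univ.filter fun i : Fin n =>
      ∀ i' : Fin n, (π (Sum.inr i') : ℕ) ≠ (π (Sum.inr i) : ℕ) + 1) with hTC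
  -- positions of the tops
  have hsub : ((range (2 * n - 1)).filter fun k => w k ≠ w (k + 1)) ⊆
      TR.image (fun i => (π (Sum.inl i) : ℕ)) ∪ TC.image (fun i => (π (Sum.inr i) : ℕ)) := by
    intro k hk
    simp only [mem_filter, mem_range] at hk
    obtain ⟨hk, hne⟩ := hk
    have hk2 : k < 2 * n := by omega
    have hk3 : k + 1 < 2 * n := by omega
    have hwk := hw ⟨k, hk2⟩
    have hwk1 := hw ⟨k + 1, hk3⟩
    simp only at hwk hwk1
    rw [mem_union, mem_image, mem_image]
    rcases hx : π.symm ⟨k, hk2⟩ with i | i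
    · -- `k` is a row position and `k + 1` is not
      left
      refine ⟨i, ?_, ?_⟩
      · rw [hTR, mem_filter]
        refine ⟨mem_univ _, fun i' hi' => ?_⟩
        have hpi : (π (Sum.inl i) : ℕ) = k := by
          rw [show π (Sum.inl i) = ⟨k, hk2⟩ by rw [← hx, Equiv.apply_symm_apply]]
        rw [hpi] at hi'
        have h1 : π.symm ⟨k + 1, hk3⟩ = Sum.inl i' := by
          rw [Equiv.symm_apply_eq]; exact (Fin.ext hi').symm
        rw [hx] at hwk
        rw [h1] at hwk1
        simp only [Sum.isLeft_inl] at hwk hwk1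
        exact hne (by rw [hwk, hwk1])
      · rw [show π (Sum.inl i) = ⟨k, hk2⟩ by rw [← hx, Equiv.apply_symm_apply]]
    · -- `k` is a column position and `k + 1` is not
      right
      refine ⟨i, ?_, ?_⟩
      · rw [hTC, mem_filter]
        refine ⟨mem_univ _, fun i' hi' => ?_⟩
        have hpi : (π (Sum.inr i) : ℕ) = k := by
          rw [show π (Sum.inr i) = ⟨k, hk2⟩ by rw [← hx, Equiv.apply_symm_apply]]
        rw [hpi] at hi'
        have h1 : π.symm ⟨k + 1, hk3⟩ = Sum.inr i' := by
          rw [Equiv.symm_apply_eq]; exact (Fin.ext hi').symm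
        rw [hx] at hwk
        rw [h1] at hwk1
        simp only [Sum.isLeft_inr] at hwk hwk1
        exact hne (by rw [hwk, hwk1])
      · rw [show π (Sum.inr i) = ⟨k, hk2⟩ by rw [← hx, Equiv.apply_symm_apply]]
  calc ((range (2 * n - 1)).filter fun k => w k ≠ w (k + 1)).card
      ≤ (TR.image (fun i => (π (Sum.inl i) : ℕ)) ∪ TC.image (fun i => (π (Sum.inr i) : ℕ))).card :=
        card_le_card hsub
    _ ≤ (TR.image (fun i => (π (Sum.inl i) : ℕ))).card + (TC.image (fun i => (π (Sum.inr i) : ℕ))).card :=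
        card_union_le _ _
    _ ≤ TR.card + TC.card := add_le_add card_image_le card_image_le

/-- ★ **Changes versus the pair.**  On EVERY cut: `#changes(w) ≤ 2 · rank M_π(λ) · rank M_π(λ_odd)`. [this file] -/
theorem changes_le_two_mul_rank_mul_rank (n : ℕ) (π : Fin n ⊕ Fin n ≃ Fin (2 * n)) (w : ℕ → Bool)
    (hw : ∀ j : Fin (2 * n), w j = (π.symm j).isLeft) :
    ((range (2 * n - 1)).filter fun k => w k ≠ w (k + 1)).card ≤
      2 * ((Matrix.of fun r c : Fin n → Bool =>
          (((liouville (Nat.ofBits (fun k : Fin (2 * n) => Sum.elim r c (π.symm k)) + 1) : ℤ) : ℂ))).rank *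
        (Matrix.of fun r c : Fin n → Bool =>
          (((liouville (Nat.ofBits (fun k : Fin (2 * n) => Sum.elim r c (π.symm k)) + 1) : ℤ) : ℂ)) *
            (-1 : ℂ) ^ ((Nat.ofBits (fun k : Fin (2 * n) => Sum.elim r c (π.symm k)) + 1).factorization 2)).rank) := by
  have h := card_changes_le_card_tops_add n π w hw
  have h1 := card_rowRunTops_le_rank_mul_rank n π
  have h2 := card_colRunTops_le_rank_mul_rank n π
  omega

/-! ### §4 The crux holds for the pair `{λ, λ_odd}` -/

/-- ★★ **`LiouvilleCutRank` for the pair `{λ, λ_odd}`, unconditionally.**  For every `W` there is `n₀` such that at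
every level `n ≥ n₀`, for EVERY balanced cut `π`, at least one of the cut matrices of `λ` and of the odd-part twin
`λ_odd(m) = λ(m)(-1)^{v₂(m)}` has rank `≥ W`:  words with `≤ 2W²` letter changes give `rank M_π(λ) ≥ W`
(`BoundedChanges.le_rank_of_changes_le`, from non-automaticity), words with more changes give
`rank(λ) · rank(λ_odd) > W²`.  (So a bad cut family for `λ` would force the odd-part twin's rank above `#changes/(2W)`.)
[this file] -/
theorem le_max_rank_liouville_oddTwin : ∀ W : ℕ, ∃ n₀ : ℕ, ∀ n : ℕ, n₀ ≤ n →
    ∀ π : Fin n ⊕ Fin n ≃ Fin (2 * n),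
      W ≤ max
        (Matrix.of fun r c : Fin n → Bool =>
          (((liouville (Nat.ofBits (fun k : Fin (2 * n) => Sum.elim r c (π.symm k)) + 1) : ℤ) : ℂ))).rank
        (Matrix.of fun r c : Fin n → Bool =>
          (((liouville (Nat.ofBits (fun k : Fin (2 * n) => Sum.elim r c (π.symm k)) + 1) : ℤ) : ℂ)) *
            (-1 : ℂ) ^ ((Nat.ofBits (fun k : Fin (2 * n) => Sum.elim r c (π.symm k)) + 1).factorization 2)).rank := by
  intro W
  obtain ⟨n₀, hn₀⟩ := le_rank_of_changes_le (2 * (W * W)) W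
  refine ⟨n₀, fun n hn π => ?_⟩
  set w : ℕ → Bool := fun k => if hk : k < 2 * n then (π.symm ⟨k, hk⟩).isLeft else false with hw_def
  have hw : ∀ j : Fin (2 * n), w j = (π.symm j).isLeft := fun j => by simp [hw_def, j.isLt]
  set a := (Matrix.of fun r c : Fin n → Bool =>
      (((liouville (Nat.ofBits (fun k : Fin (2 * n) => Sum.elim r c (π.symm k)) + 1) : ℤ) : ℂ))).rank with ha
  set b := (Matrix.of fun r c : Fin n → Bool =>
      (((liouville (Nat.ofBits (fun k : Fin (2 * n) => Sum.elim r c (π.symm k)) + 1) : ℤ) : ℂ)) *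
        (-1 : ℂ) ^ ((Nat.ofBits (fun k : Fin (2 * n) => Sum.elim r c (π.symm k)) + 1).factorization 2)).rank
    with hb
  by_cases hc : ((range (2 * n - 1)).filter fun k => w k ≠ w (k + 1)).card ≤ 2 * (W * W)
  · exact (hn₀ n hn π w hw hc).trans (le_max_left _ _)
  · have h := changes_le_two_mul_rank_mul_rank n π w hw
    rw [← ha, ← hb] at h
    have hab : W * W < a * b := by omega
    -- if both ranks were `< W` the product would be `< W²`
    by_contra hlt
    rw [not_le, max_lt_iff] at hlt
    have : a * b < W * W := Nat.mul_lt_mul'' hlt.1 hlt.2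
    omega

end Summit.ValiantsHypothesis.ValiantsHypothesis.Theorems.LiouvilleSarnakLiouvilleCutRank.ManyChanges

end
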